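import Mathlib
import HarnessLib
import Summits.Ventures.LatticeQCDFlow.Scaling.TorusAcceptanceSandwich2D
import Summits.Ventures.LatticeQCDFlow.Scaling.TorusEssLossSandwich2D
import Summits.Ventures.LatticeQCDFlow.Scaling.TiltPiReindexCentring
import Summits.Ventures.LatticeQCDFlow.Scaling.GiniMeanDifferenceCLT

/-!
# LatticeQCDFlow / Scaling — THE STRONG-COUPLING SLOPE ON THE TORUS: the half Gini mean difference of the
# Wilson action under product Haar on the periodic `L × L` torus is that of the factorised `(L² − 1)`-plaquette
# sum up to `±N`, hence `½·E|S − S′| / L → σ/√π`, `σ² = Var_Haar(Re tr ρ)` — every compact gauge group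

HONEST FRAMING: exact (Metropolis-corrected) sampling algorithms for lattice gauge theory;
figures of merit are autocorrelation/cost numbers at stated couplings and volumes; no
continuum-physics claim.

Venture `LatticeQCDFlow` (cell pub-lqcd), topic `Scaling`; FANOUT row 3 (`s0-u1-a`, S0-B
implementation A, GEN-21).  NEW WORK of the cell, no numerics, NO definition.  GEN-17 (D)
(`Scaling/IdentityFlowAcceptanceStrongCoupling`, staged) identifies the first-order strong-coupling law of
the untrained sampler's acceptance, `(1 − acc(β))/β → s = ½·E_{μ⊗μ}|S − S′|` (half the Gini mean
difference of the action under the reference law), for every reference law `μ` — so on the torus with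
`μ = Haar^{⊗E}`; GEN-19's `Scaling/GiniMeanDifferenceCLT.pi_halfGini_sum_div_sqrt_tendsto` gives the
factorised constant `s_n/√n → σ/√π`.  This file transfers the constant to the periodic two-dimensional
torus: splitting `S(U) − S(U′)` at a puncture (`Scaling/TorusAcceptanceSandwich2D.integral_comp_plaquettes`,
row 30's `map_plaquettes_eq_pi`), the punctured-plaquette term moves the pair integral by at most `2N`:

* §0 (bookkeeping shared with `Scaling/TorusWindowEssLoss2D`, `TorusCouplingSequences2D`)
  `tendsto_sqrt_punctured_div` (`√((k+2)² − 1)/(k+2) → 1`), `tendsto_mul_sqrt_punctured`,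
  `tendsto_zero_of_mul_tendsto`;
* §1 `pairAbsDiff_reindex` (the pair integral `∫∫|Σf(y) − Σf(y′)|` is invariant under re-indexing the blocks),
  **`torus_halfGini_sandwich`** — for `L ≥ 2`, every compact second-countable `G`, continuous `ρ`, puncture
  `x₀`: `|½∫∫|S(U) − S(U′)| dHaar^{⊗E}² − ½∫∫|T(z) − T(z′)| dHaar^{⊗Fin(L²−1)}²| ≤ N`,
  `T(z) = Σᵢ (Re tr ρ(zᵢ) − N)`;
* §2 **`torus_halfGini_div_tendsto`** — `(½∫∫|S − S′| dHaar^{⊗E}²)/L → √(σ²/π)` along `L = k + 2`: with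
  GEN-17 (D), the strong-coupling slope of the untrained sampler's acceptance on the `L × L` torus is
  `σL/√π·(1 + o(1))` — the same leading constant as the factorised model (GEN-18/19), the torus constraint
  being `O(1)` out of `O(L)`.

NOT CLAIMED: the slope law itself on the torus is GEN-17 (D) with `μ = Haar^{⊗E}` (not restated); second
order (see `Scaling/StrongCouplingExtensive`); `d ≥ 3`; any value at the cell's `(β, L)`; nothing re-scored,
SEALED.md untouched.
-/

noncomputable section

namespace Summit.Ventures.LatticeQCDFlow.Theory2

open MeasureTheory ProbabilityTheory Filter Finset Real Set
open Literature.MathematicalPhysics.QuantumFieldTheory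
open scoped Topology

/-! ## §0 The punctured-volume parametrisation -/

section Param

/-- `√((k+2)² − 1)/(k+2) → 1`. [folklore] -/
theorem tendsto_sqrt_punctured_div :
    Tendsto (fun k : ℕ => Real.sqrt ((((k + 2) ^ 2 - 1 : ℕ)) : ℝ) / ((k : ℝ) + 2)) atTop (𝓝 1) := by
  -- `√(n_k)/(k+2) = √(1 − 1/(k+2)²)`
  have hk : ∀ k : ℕ, Real.sqrt ((((k + 2) ^ 2 - 1 : ℕ)) : ℝ) / ((k : ℝ) + 2) =
      Real.sqrt (1 - 1 / ((k : ℝ) + 2) ^ 2) := by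
    intro k
    have hpos : (0 : ℝ) < (k : ℝ) + 2 := by positivity
    have h1 : 1 ≤ (k + 2) ^ 2 := Nat.one_le_pow _ _ (by omega)
    rw [Nat.cast_sub h1]
    push_cast
    rw [show (1 : ℝ) - 1 / ((k : ℝ) + 2) ^ 2 = (((k : ℝ) + 2) ^ 2 - 1) / ((k : ℝ) + 2) ^ 2 by
      field_simp, Real.sqrt_div' _ (sq_nonneg _), Real.sqrt_sq hpos.le]
  simp_rw [hk]
  have h0 : Tendsto (fun k : ℕ => 1 - 1 / ((k : ℝ) + 2) ^ 2) atTop (𝓝 (1 - 0)) := by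
    refine tendsto_const_nhds.sub ?_
    have ht : Tendsto (fun k : ℕ => ((k : ℝ) + 2) ^ 2) atTop atTop := by
      refine (tendsto_pow_atTop two_ne_zero).comp ?_
      exact tendsto_atTop_add_const_right _ _ tendsto_natCast_atTop_atTop
    exact tendsto_const_nhds.div_atTop ht
  rw [sub_zero] at h0
  have := (Real.continuous_sqrt.tendsto 1).comp h0
  rwa [Function.comp_def, Real.sqrt_one] at this

/-- `β_k·(k+2) → c ⇒ β_k·√((k+2)² − 1) → c`. [folklore] -/
theorem tendsto_mul_sqrt_punctured {β : ℕ → ℝ} {c : ℝ}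
    (hβ : Tendsto (fun k : ℕ => β k * ((k : ℝ) + 2)) atTop (𝓝 c)) :
    Tendsto (fun k : ℕ => β k * Real.sqrt ((((k + 2) ^ 2 - 1 : ℕ)) : ℝ)) atTop (𝓝 c) := by
  have h := hβ.mul tendsto_sqrt_punctured_div
  rw [mul_one] at h
  refine h.congr fun k => ?_
  have hpos : (0 : ℝ) < (k : ℝ) + 2 := by positivity
  field_simp

/-- `β_k·(k+2) → c ⇒ β_k → 0`. [folklore] -/
theorem tendsto_zero_of_mul_tendsto {β : ℕ → ℝ} {c : ℝ}
    (hβ : Tendsto (fun k : ℕ => β k * ((k : ℝ) + 2)) atTop (𝓝 c)) :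
    Tendsto β atTop (𝓝 0) := by
  have ht : Tendsto (fun k : ℕ => ((k : ℝ) + 2)) atTop atTop :=
    tendsto_atTop_add_const_right _ _ tendsto_natCast_atTop_atTop
  have h := hβ.div_atTop ht
  refine h.congr fun k => ?_
  have hpos : (0 : ℝ) < (k : ℝ) + 2 := by positivity
  field_simp



end Param

/-! ## §1 The half Gini mean difference of the action: torus versus factorised -/

section Gini

variable {X : Type*} [MeasurableSpace X] (ν : Measure X) [SigmaFinite ν] {ι : Type*} [Fintype ι] {n : ℕ}

/-- The pair integral `∫∫|Σₓ f(yₓ) − Σₓ f(y′ₓ)|` is invariant under re-indexing the blocks along `ι ≃ Fin n`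
(`Scaling/TiltPiReindexCentring.integral_comp_sum_piCongrLeft`, twice). [ours] -/
theorem pairAbsDiff_reindex (e : ι ≃ Fin n) (f : X → ℝ) :
    ∫ y, ∫ y', |∑ x, f (y x) - ∑ x, f (y' x)| ∂(Measure.pi fun _ : ι => ν) ∂(Measure.pi fun _ : ι => ν) =
      ∫ z, ∫ z', |∑ i, f (z i) - ∑ i, f (z' i)| ∂(Measure.pi fun _ : Fin n => ν)
        ∂(Measure.pi fun _ : Fin n => ν) := by
  have hin : ∀ s : ℝ, ∫ z', |s - ∑ i, f (z' i)| ∂(Measure.pi fun _ : Fin n => ν) =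
      ∫ y', |s - ∑ x, f (y' x)| ∂(Measure.pi fun _ : ι => ν) :=
    fun s => integral_comp_sum_piCongrLeft ν e f (fun t => |s - t|)
  have hout := integral_comp_sum_piCongrLeft ν e f
    (fun s => ∫ y', |s - ∑ x, f (y' x)| ∂(Measure.pi fun _ : ι => ν))
  simp only at hout
  simp_rw [hin]
  exact hout.symm

variable {L N : ℕ} {G : Type*} [Group G] [TopologicalSpace G] [IsTopologicalGroup G]
  [CompactSpace G] [SecondCountableTopology G] [MeasurableSpace G] [BorelSpace G]
  (ρ : G →* Matrix (Fin N) (Fin N) ℂ)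

/-- **THE TORUS GINI SANDWICH**: on `(ℤ/L)²`, `L ≥ 2`, for every compact second-countable `G`, continuous `ρ`
and puncture `x₀`, the half Gini mean difference of the Wilson action under product Haar differs from the
factorised `(L² − 1)`-plaquette one (`Fin`-indexed, statistic `Re tr ρ − N`) by at most `N`. [ours] -/
theorem torus_halfGini_sandwich [NeZero L] (hL : 2 ≤ L) (x₀ : Site 2 L) (hρ : Continuous ρ) :
    |(1 / 2 * ∫ U, ∫ U', |wilsonAction ρ U - wilsonAction ρ U'|
          ∂(Measure.pi fun _ : Edge 2 L => haarProbability G) ∂(Measure.pi fun _ : Edge 2 L => haarProbability G)) -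
      1 / 2 * ∫ z, ∫ z', |∑ i, ((ρ (z i)).trace.re - N) - ∑ i, ((ρ (z' i)).trace.re - N)|
          ∂(Measure.pi fun _ : Fin (L ^ 2 - 1) => haarProbability G)
          ∂(Measure.pi fun _ : Fin (L ^ 2 - 1) => haarProbability G)| ≤ N := by
  set μE : Measure (GaugeConfig 2 L G) := Measure.pi fun _ : Edge 2 L => haarProbability G with hμE
  set μI : Measure ({x : Site 2 L // x ≠ x₀} → G) :=
    Measure.pi fun _ : {x : Site 2 L // x ≠ x₀} => haarProbability G with hμI
  set T : ({x : Site 2 L // x ≠ x₀} → G) → ℝ := fun y => ∑ x, ((ρ (y x)).trace.re - N) with hT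
  set plq : GaugeConfig 2 L G → ({x : Site 2 L // x ≠ x₀} → G) :=
    fun U x => plaquetteHolonomy U x.1 0 1 with hplq
  set a : GaugeConfig 2 L G → ℝ := fun U => (N : ℝ) - (ρ (plaquetteHolonomy U x₀ 0 1)).trace.re with ha
  have hr : Continuous fun g : G => (ρ g).trace.re := Complex.continuous_re.comp hρ.matrix_trace
  have hTc : Continuous T :=
    continuous_finsetSum _ fun x _ => (hr.comp (continuous_apply x)).sub continuous_const
  -- the split `S(U) = a(U) − T(plq U)` and `0 ≤ a ≤ 2N`
  have hsplit : ∀ U : GaugeConfig 2 L G, wilsonAction ρ U = a U - T (plq U) := by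
    intro U
    rw [TrivializingMaps.wilsonAction_two_eq_sum_sites ρ, sum_site_eq_add_sum_ne x₀]
    simp only [ha, hT, hplq, Finset.sum_sub_distrib, Finset.sum_const, Finset.card_univ]
    ring
  have habs : ∀ U U' : GaugeConfig 2 L G,
      |(|wilsonAction ρ U - wilsonAction ρ U'| - |T (plq U) - T (plq U')|)| ≤ 2 * N := by
    intro U U'
    have h1 := Literature.RepresentationTheory.CompactGroups.CompactGroup.abs_re_trace_le_card ρ hρ
      (plaquetteHolonomy U x₀ 0 1)
    have h2 := Literature.RepresentationTheory.CompactGroups.CompactGroup.abs_re_trace_le_card ρ hρ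
      (plaquetteHolonomy U' x₀ 0 1)
    rw [Fintype.card_fin] at h1 h2
    have ha1 := abs_le.1 h1
    have ha2 := abs_le.1 h2
    rw [hsplit U, hsplit U']
    have e : a U - T (plq U) - (a U' - T (plq U')) = (a U - a U') + -(T (plq U) - T (plq U')) := by ring
    rw [e]
    have key := abs_abs_sub_abs_le (a U - a U' + -(T (plq U) - T (plq U'))) (-(T (plq U) - T (plq U')))
    rw [abs_neg, add_sub_cancel_right] at key
    refine key.trans ?_
    simp only [ha]
    rw [abs_le]; constructor <;> linarith [ha1.1, ha1.2, ha2.1, ha2.2]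
  -- integrability (everything is bounded and measurable on a probability space)
  have hSm : Measurable fun U : GaugeConfig 2 L G => wilsonAction ρ U := WilsonRP.measurable_wilsonAction ρ hρ
  have hplqm : Measurable plq := measurable_pi_lambda _ fun x => Lattice.TwoDim.measurable_plaquetteHolonomy (G := G) x.1
  obtain ⟨B, hB⟩ := exists_abs_wilsonAction_le (d := 2) (L := L) ρ hρ
  have hTb : ∀ y, |T y| ≤ ∑ _x : {x : Site 2 L // x ≠ x₀}, (2 * (N : ℝ)) := fun y =>
    (Finset.abs_sum_le_sum_abs _ _).trans (Finset.sum_le_sum fun x _ => by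
      have h := Literature.RepresentationTheory.CompactGroups.CompactGroup.abs_re_trace_le_card ρ hρ (y x)
      rw [Fintype.card_fin] at h
      have h' := abs_le.1 h
      rw [abs_le]; constructor <;> linarith [h'.1, h'.2])
  set C : ℝ := ∑ _x : {x : Site 2 L // x ≠ x₀}, (2 * (N : ℝ)) with hC
  -- the pair functionals as product-space integrals
  have hF1 : Integrable (fun z : GaugeConfig 2 L G × GaugeConfig 2 L G =>
      |wilsonAction ρ z.1 - wilsonAction ρ z.2|) (μE.prod μE) :=
    Integrable.of_mem_Icc 0 (B + B) ((hSm.comp measurable_fst).sub (hSm.comp measurable_snd)).abs.aemeasurable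
      (ae_of_all _ fun z => ⟨abs_nonneg _, (abs_sub _ _).trans (add_le_add (hB _) (hB _))⟩)
  have hF2 : Integrable (fun z : GaugeConfig 2 L G × GaugeConfig 2 L G =>
      |T (plq z.1) - T (plq z.2)|) (μE.prod μE) :=
    Integrable.of_mem_Icc 0 (C + C)
      (((hTc.measurable.comp hplqm).comp measurable_fst).sub
        ((hTc.measurable.comp hplqm).comp measurable_snd)).abs.aemeasurable
      (ae_of_all _ fun z => ⟨abs_nonneg _, (abs_sub _ _).trans (add_le_add (hTb _) (hTb _))⟩)
  have e1 : ∫ U, ∫ U', |wilsonAction ρ U - wilsonAction ρ U'| ∂μE ∂μE =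
      ∫ z, |wilsonAction ρ z.1 - wilsonAction ρ z.2| ∂(μE.prod μE) := (integral_prod _ hF1).symm
  have e2 : ∫ U, ∫ U', |T (plq U) - T (plq U')| ∂μE ∂μE =
      ∫ z, |T (plq z.1) - T (plq z.2)| ∂(μE.prod μE) := (integral_prod _ hF2).symm
  have hdiff : |∫ U, ∫ U', |wilsonAction ρ U - wilsonAction ρ U'| ∂μE ∂μE -
      ∫ U, ∫ U', |T (plq U) - T (plq U')| ∂μE ∂μE| ≤ 2 * N := by
    rw [e1, e2, ← integral_sub hF1 hF2]
    refine (abs_integral_le_integral_abs).trans ?_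
    calc ∫ z, |(|wilsonAction ρ z.1 - wilsonAction ρ z.2| - |T (plq z.1) - T (plq z.2)|)| ∂(μE.prod μE)
        ≤ ∫ _z, 2 * (N : ℝ) ∂(μE.prod μE) :=
          integral_mono_of_nonneg (ae_of_all _ fun z => abs_nonneg _) (integrable_const _)
            (ae_of_all _ fun z => habs z.1 z.2)
      _ = 2 * N := by rw [integral_const, probReal_univ, one_smul]
  -- push the factorised pair integral forward and re-index
  have hΘ : StronglyMeasurable fun y => ∫ y', |T y - T y'| ∂μI :=
    StronglyMeasurable.integral_prod_right'
      ((hTc.comp continuous_fst).sub (hTc.comp continuous_snd)).abs.stronglyMeasurable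
  have hpush : ∫ U, ∫ U', |T (plq U) - T (plq U')| ∂μE ∂μE = ∫ y, ∫ y', |T y - T y'| ∂μI ∂μI := by
    have inner : ∀ U, ∫ U', |T (plq U) - T (plq U')| ∂μE = ∫ y', |T (plq U) - T y'| ∂μI := fun U =>
      integral_comp_plaquettes hL x₀ (continuous_const.sub hTc).abs.stronglyMeasurable
    simp_rw [inner]
    exact integral_comp_plaquettes hL x₀ hΘ
  have e : {x : Site 2 L // x ≠ x₀} ≃ Fin (L ^ 2 - 1) := Fintype.equivFinOfCardEq (card_site_ne x₀)
  have hre := pairAbsDiff_reindex (haarProbability G) e (fun g => (ρ g).trace.re - N)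
  rw [hpush] at hdiff
  simp only [hT] at hdiff
  rw [hre] at hdiff
  rw [← mul_sub, abs_mul, abs_of_pos (by norm_num : (0 : ℝ) < 1 / 2)]
  linarith

end Gini

/-! ## §2 The constant `σ/√π` on the torus -/

section Constant

variable {N : ℕ} {G : Type*} [Group G] [TopologicalSpace G] [IsTopologicalGroup G]
  [CompactSpace G] [SecondCountableTopology G] [MeasurableSpace G] [BorelSpace G]
  (ρ : G →* Matrix (Fin N) (Fin N) ℂ)

/-- **THE STRONG-COUPLING SLOPE CONSTANT ON THE TORUS**: along `L = k + 2 → ∞`,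
`(½∫∫|S(U) − S(U′)| dHaar^{⊗E}²)/L → √(Var_Haar(Re tr ρ)/π)` for every compact second-countable `G` and
continuous `ρ` — GEN-19's `pi_halfGini_sum_div_sqrt_tendsto` along the punctured volumes, transferred by
`torus_halfGini_sandwich`. [ours] -/
theorem torus_halfGini_div_tendsto (hρ : Continuous ρ) :
    Tendsto (fun k : ℕ => (1 / 2 * ∫ U, ∫ U', |wilsonAction ρ U - wilsonAction ρ U'|
        ∂(Measure.pi fun _ : Edge 2 (k + 2) => haarProbability G)
        ∂(Measure.pi fun _ : Edge 2 (k + 2) => haarProbability G)) / ((k : ℝ) + 2))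
      atTop (𝓝 (Real.sqrt (Var[fun g : G => (ρ g).trace.re; haarProbability G] / π))) := by
  have hr : Continuous fun g : G => (ρ g).trace.re := Complex.continuous_re.comp hρ.matrix_trace
  have hg2 : MemLp (fun g : G => (ρ g).trace.re - N) 2 (haarProbability G) := by
    refine memLp_of_bounded (a := -(2 * N)) (b := 2 * N) (ae_of_all _ fun g => abs_le.1 ?_)
      (hr.sub continuous_const).aestronglyMeasurable 2
    exact abs_re_trace_sub_card_le ρ hρ g
  have hVar : Var[fun g : G => (ρ g).trace.re - N; haarProbability G] =
      Var[fun g : G => (ρ g).trace.re; haarProbability G] := variance_sub_const hr.aestronglyMeasurable _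
  -- GEN-19's factorised constant along `n_k = (k+2)² − 1`, rescaled by `√n_k/(k+2) → 1`
  have hF := ((pi_halfGini_sum_div_sqrt_tendsto hg2).comp tendsto_puncturedVolume_atTop).mul
    tendsto_sqrt_punctured_div
  rw [hVar, mul_one] at hF
  -- the torus term differs by at most `N`, and `N/(k+2) → 0`
  have hN : Tendsto (fun k : ℕ => (N : ℝ) / ((k : ℝ) + 2)) atTop (𝓝 0) :=
    tendsto_const_nhds.div_atTop (tendsto_atTop_add_const_right _ _ tendsto_natCast_atTop_atTop)
  have hlo := hF.sub hN
  have hhi := hF.add hN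
  rw [sub_zero] at hlo
  rw [add_zero] at hhi
  refine tendsto_of_tendsto_of_tendsto_of_le_of_le hlo hhi (fun k => ?_) (fun k => ?_)
  · have hk := abs_le.1 (torus_halfGini_sandwich ρ (by omega : 2 ≤ k + 2) (0 : Site 2 (k + 2)) hρ)
    have hpos : (0 : ℝ) < (k : ℝ) + 2 := by positivity
    have hs : Real.sqrt ((((k + 2) ^ 2 - 1 : ℕ)) : ℝ) ≠ 0 := by
      apply (Real.sqrt_pos.2 _).ne'
      have h1 : 1 < (k + 2) ^ 2 := Nat.one_lt_pow two_ne_zero (by omega)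
      exact Nat.cast_pos.2 (Nat.sub_pos_of_lt h1)
    simp only [Function.comp_apply]
    rw [div_mul_div_cancel₀ hs, ← sub_div, div_le_div_iff_of_pos_right hpos]
    linarith [hk.1]
  · have hk := abs_le.1 (torus_halfGini_sandwich ρ (by omega : 2 ≤ k + 2) (0 : Site 2 (k + 2)) hρ)
    have hpos : (0 : ℝ) < (k : ℝ) + 2 := by positivity
    have hs : Real.sqrt ((((k + 2) ^ 2 - 1 : ℕ)) : ℝ) ≠ 0 := by
      apply (Real.sqrt_pos.2 _).ne'
      have h1 : 1 < (k + 2) ^ 2 := Nat.one_lt_pow two_ne_zero (by omega)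
      exact Nat.cast_pos.2 (Nat.sub_pos_of_lt h1)
    simp only [Function.comp_apply]
    rw [div_mul_div_cancel₀ hs, ← add_div, div_le_div_iff_of_pos_right hpos]
    linarith [hk.2]

end Constant

end Summit.Ventures.LatticeQCDFlow.Theory2

end
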